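import Summits.ResolutionOfSingularities.ResolutionOfSingularities.Theorems.MarkedTransferCampaignW46ThreefoldsGammaFreeGlobalMeasureAway
import HarnessLib

/-!
# [OURS · L1 W4.6 rung (ii), dimension ladder] THE TERMINATION MEASURE OVER THE BLOWN-UP POINT: the local terms at the points of
# the exceptional curve for a family of LIFTED branches (brick B10b-fibre of rung (ii-2) `GammaFreeGlobalOrderReductionDimLE p 2`)

Cell res-hironaka, LADDER-RESOLUTION rung L (D-0089), slot W4.6, rung (ii) (dimension ladder, res-L1-type-o1 p496755); seat
res-D-pv-049 AS res-L1-s46-pv-11 (holder of rung (ii-2); architecture v2, STATUS 2026-08-27T05:4xZ). Host route MarkedTransfer,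
host item `HypersurfaceOrderReductionDimLeThree` (stmt-ResolutionOfSingularities-16156); proposed `--kind proof --supports` it
`--as helper`. Everything here is OURS bookkeeping over bricks B10b-loc / B10b-away; nothing of H. Hironaka's manuscript
[Hironaka2017] is asserted. AI-written; AI review is weaker than expert review.

## Setting and what is proved

`π : X′ → X` the blowing up of the regular integral `X` at a closed point `x` with `dim 𝒪_{X,x} = 2`; an injective finite family
`ζ : ι → X` of codimension-one points (the branches) with curves `C_k` LIFTED to closed immersions `j_k : C_k ↪ X′` with
`j_k ≫ π` a closed immersion onto `cl ζ_k` (brick B10b-reg, the case of branches regular at `x`), the exceptional generic point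
`η`, and the new family `ζ′ : ι ⊕ σ → X′`, `ζ′(inl k) = j_k(η_{C_k})`, `ζ′(inr s) = η` (`σ` a subsingleton).

* `pairTangencyAt_inl_inr_eq_zero` — the tangency term of an old branch with the exceptional curve vanishes everywhere (U2).
* `finsum_mem_preimage_pairTangencyAt_le`, `…_add_one_le` — over `x`, the tangency terms of a pair of old branches sum to at most
  the old term at `x`, and to at most the old term MINUS ONE when the pair is tangent at `x` (U1 + Noether's inequality U3 +
  finiteness of `i_x`).
* `branchCount_le_two_of_transversal` — if all pairs of branches through `x` are transversal, every point over `x` carries at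
  most two branches of the new family.

## Sources

* R. Hartshorne, *Algebraic Geometry* (1977), Ch. V Prop. 3.6, Cor. 3.7, Thm. 3.9. [Hartshorne1977]
* H. Hironaka, ms. 2017-03-23, Def. 2.1 p.5 — scope only, under adjudication, not cited as fact. [Hironaka2017]
-/

noncomputable section

set_option linter.dupNamespace false -- mandated namespace of this single-conjunct summit

open CategoryTheory AlgebraicGeometry TopologicalSpace IsLocalRing Topology

namespace Summit.ResolutionOfSingularities.ResolutionOfSingularities.Theorems

namespace CampaignW46

open Literature.AlgebraicGeometry.Resolution
open Scheme.IdealSheafData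

universe u

/-- Transport of `mem_regularLocus_iff_of_isClosedImmersion` along point equalities. [folklore] -/
theorem mem_regularLocus_iff_of_isClosedImmersion' {X C : Scheme.{u}} [IsIntegral C] (i : C ⟶ X) [IsClosedImmersion i]
    (c : C) {y ζ₀ : X} (hy : i c = y) (hζ₀ : i (genericPoint C) = ζ₀) :
    c ∈ Scheme.regularLocus C ↔ IsRegularLocalRing (X.presheaf.stalk y ⧸ stalkIdeal (primeDivisorIdeal ζ₀) y) := by
  subst hy; subst hζ₀
  exact mem_regularLocus_iff_of_isClosedImmersion i c

/-- **The local intersection number of two distinct branches at a point with two-dimensional regular local ring is finite**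
(their primes are generated by non-associated prime elements; res-D-pv-047's `length_quotient_span_pair_ne_top_of_isRelPrime`).
[cite: Matsumura1987, Thm. 20.3] -/
theorem pairLength_ne_top {X : Scheme.{u}} [IsIntegral X] (hX : Scheme.IsRegular X) {ζ₁ ζ₂ y : X}
    (hy : ringKrullDim (X.presheaf.stalk y) = 2) (h₁ : ζ₁ ⤳ y) (h₂ : ζ₂ ⤳ y) (hc₁ : Order.coheight ζ₁ = 1)
    (hc₂ : Order.coheight ζ₂ = 1) (hne : ζ₁ ≠ ζ₂) : pairLength ζ₁ ζ₂ y ≠ ⊤ := by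
  haveI : IsRegularLocalRing (X.presheaf.stalk y) := hX y
  have hUFD := Scheme.IsRegular.uniqueFactorizationMonoid_stalk hX
  obtain ⟨f, hf, hf'⟩ := exists_stalkIdeal_primeDivisorIdeal_eq_span hUFD h₁ hc₁
  obtain ⟨g, hg, hg'⟩ := exists_stalkIdeal_primeDivisorIdeal_eq_span hUFD h₂ hc₂
  have hassoc : ¬ Associated f g := by
    intro h
    have heq : stalkIdeal (primeDivisorIdeal ζ₁) y = stalkIdeal (primeDivisorIdeal ζ₂) y := by
      rw [hf', hg']; exact Ideal.span_singleton_eq_span_singleton.mpr h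
    exact hne ((eq_of_stalkIdeal_primeDivisorIdeal_le h₁ h₂ heq.le).antisymm
      (eq_of_stalkIdeal_primeDivisorIdeal_le h₂ h₁ heq.ge)).eq
  rw [pairLength_def, hf', hg', ← Ideal.span_insert]
  exact length_quotient_span_pair_ne_top_of_isRelPrime hy (isRelPrime_of_prime_of_not_associated hf hg hassoc)

/-- `1 ≤ i_y` for two branches through `y`. [folklore] -/
theorem one_le_pairLength {X : Scheme.{u}} {ζ₁ ζ₂ y : X} (h₁ : ζ₁ ⤳ y) (h₂ : ζ₂ ⤳ y) :
    1 ≤ pairLength ζ₁ ζ₂ y := by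
  rw [pairLength_def, one_le_length_quotient_iff]
  refine sup_le (IsLocalRing.le_maximalIdeal ?_) (IsLocalRing.le_maximalIdeal ?_)
  · rw [stalkIdeal_primeDivisorIdeal h₁]
    exact Ideal.IsPrime.ne_top inferInstance
  · rw [stalkIdeal_primeDivisorIdeal h₂]
    exact Ideal.IsPrime.ne_top inferInstance

section Fibre

variable {X X' : Scheme.{u}} [IsIntegral X] [IsLocallyNoetherian X] (hX : Scheme.IsRegular X)
  {x : X} (hx : IsClosed ({x} : Set X)) (hxne : ({x} : Set X) ≠ Set.univ) (hR2 : ringKrullDim (X.presheaf.stalk x) = 2)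
  {π : X' ⟶ X} (hπ : IsBlowup π (vanishingIdeal ⟨{x}, hx⟩))
  {ι σ : Type} (ζ : ι → X) (hζinj : Function.Injective ζ) (hcoh : ∀ k, Order.coheight (ζ k) = 1) (hζx : ∀ k, ζ k ≠ x)
  (C : ι → Scheme.{u}) [∀ k, IsIntegral (C k)] (j : ∀ k, C k ⟶ X') [∀ k, IsClosedImmersion (j k)]
  [∀ k, IsClosedImmersion (j k ≫ π)] (hjζ : ∀ k, π (j k (genericPoint (C k))) = ζ k)
  {η : X'} (hη : IsGenericPoint η (π ⁻¹' ({x} : Set X)))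
  (ζ' : ι ⊕ σ → X') (hinl : ∀ k, ζ' (Sum.inl k) = j k (genericPoint (C k))) (hinr : ∀ s, ζ' (Sum.inr s) = η)

omit [IsIntegral X] [IsLocallyNoetherian X] [∀ k, IsClosedImmersion (j k)] in
include hjζ in
/-- A branch through `x` has a point of its curve over `x`. [folklore] -/
theorem exists_apply_eq_of_specializes {k : ι} (hk : ζ k ⤳ x) : ∃ c : C k, π (j k c) = x := by
  have h : (j k ≫ π) (genericPoint (C k)) ⤳ x := by rw [Scheme.Hom.comp_apply, hjζ]; exact hk
  obtain ⟨c, hc⟩ := (specializes_iff_exists_eq_of_isClosedImmersion (j k ≫ π) x).mp h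
  exact ⟨c, by rw [← Scheme.Hom.comp_apply]; exact hc⟩

omit [IsIntegral X] [IsLocallyNoetherian X] in
include hinl in
/-- A point over `x` through which the lifted branch `k` passes is `j_k c` for the point `c` of `C_k` over `x` (U1).
[folklore] -/
theorem eq_of_inl_specializes {k : ι} {y' : X'} (hy' : π y' = x) (hk : ζ' (Sum.inl k) ⤳ y') {c : C k}
    (hc : π (j k c) = x) : y' = j k c :=
  eq_of_specializes_lift (j k) (hy'.trans hc.symm) (by rw [← hinl]; exact hk)

omit [IsIntegral X] [IsLocallyNoetherian X] [∀ k, IsClosedImmersion (j k)] [∀ k, IsClosedImmersion (j k ≫ π)] in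
include hjζ hinl in
/-- If the lifted branch `k` passes through a point over `x` then the branch `k` passes through `x`. [folklore] -/
theorem specializes_of_inl_specializes {k : ι} {y' : X'} (hy' : π y' = x) (hk : ζ' (Sum.inl k) ⤳ y') : ζ k ⤳ x := by
  have := hk.map π.continuous
  rwa [hinl, hjζ, hy'] at this

omit [IsIntegral X] in
include hX hπ hjζ hη hinl hinr in
/-- **(U2 in the family) The tangency term of an old branch with the exceptional branch vanishes at every point.**
[cite: Hartshorne1977, Ch. V Prop. 3.6] -/
theorem pairTangencyAt_inl_inr_eq_zero (k : ι) (s : σ) (y' : X') :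
    pairTangencyAt ζ' (Sum.inl k) (Sum.inr s) y' = 0 ∧ pairTangencyAt ζ' (Sum.inr s) (Sum.inl k) y' = 0 := by
  suffices h : pairTangencyAt ζ' (Sum.inl k) (Sum.inr s) y' = 0 by
    exact ⟨h, by rw [pairTangencyAt_comm]; exact h⟩
  by_cases hth : ζ' (Sum.inl k) ⤳ y' ∧ ζ' (Sum.inl k) ≠ y' ∧ ζ' (Sum.inr s) ⤳ y' ∧ ζ' (Sum.inr s) ≠ y'
  · have hy' : π y' = x := by
      have h := hth.2.2.1.map π.continuous
      rw [hinr, apply_excGen_eq hη] at h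
      exact (h.mem_closed hx rfl).symm ▸ rfl
    obtain ⟨c, hc⟩ := exists_apply_eq_of_specializes ζ C j hjζ (specializes_of_inl_specializes ζ C j hjζ ζ' hinl hy' hth.1)
    have hyc := eq_of_inl_specializes C j ζ' hinl hy' hth.1 hc
    subst hyc; subst hc
    rw [pairTangencyAt_of_through hth, hinl, hinr, pairLength_lift_excGen hX (j k) hx hπ hη, ENat.toNat_one]
  · exact pairTangencyAt_of_not_through hth

include hX hxne hR2 hπ hζinj hcoh hζx hjζ hinl in
/-- **Over `x`, the tangency terms of a pair of old branches: at most the old term, and one less if the pair is tangent at `x`.**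
The only point over `x` through which the lifted branch `k` passes is `j_k c` (U1); there Noether's inequality `i′ + 1 ≤ i_x` (U3) and
the finiteness of `i_x` give the bound. [cite: Hartshorne1977, Ch. V Cor. 3.7] -/
theorem finsum_mem_preimage_pairTangencyAt_le {k l : ι} (hkl : k ≠ l) :
    ∑ᶠ y' ∈ π ⁻¹' ({x} : Set X), pairTangencyAt ζ' (Sum.inl k) (Sum.inl l) y' ≤ pairTangencyAt ζ k l x ∧
    (ζ k ⤳ x → ζ l ⤳ x → stalkIdeal (primeDivisorIdeal (ζ k)) x ⊔ stalkIdeal (primeDivisorIdeal (ζ l)) x ≠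
        maximalIdeal (X.presheaf.stalk x) →
      ∑ᶠ y' ∈ π ⁻¹' ({x} : Set X), pairTangencyAt ζ' (Sum.inl k) (Sum.inl l) y' + 1 ≤ pairTangencyAt ζ k l x) := by
  -- if one of the branches misses `x`, everything over `x` vanishes
  by_cases hk : ζ k ⤳ x
  swap
  · have h0 : ∑ᶠ y' ∈ π ⁻¹' ({x} : Set X), pairTangencyAt ζ' (Sum.inl k) (Sum.inl l) y' = 0 :=
      finsum_mem_of_eqOn_zero fun y' hy' => pairTangencyAt_of_not_through fun h =>
        hk (specializes_of_inl_specializes ζ C j hjζ ζ' hinl hy' h.1)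
    exact ⟨by rw [h0]; exact Nat.zero_le _, fun h => absurd h hk⟩
  by_cases hl : ζ l ⤳ x
  swap
  · have h0 : ∑ᶠ y' ∈ π ⁻¹' ({x} : Set X), pairTangencyAt ζ' (Sum.inl k) (Sum.inl l) y' = 0 :=
      finsum_mem_of_eqOn_zero fun y' hy' => pairTangencyAt_of_not_through fun h =>
        hl (specializes_of_inl_specializes ζ C j hjζ ζ' hinl hy' h.2.2.1)
    exact ⟨by rw [h0]; exact Nat.zero_le _, fun _ h => absurd h hl⟩
  -- the point `c` of `C_k` over `x`; the only contribution over `x` is at `j_k c`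
  obtain ⟨c, hc⟩ := exists_apply_eq_of_specializes ζ C j hjζ hk
  have hsum : ∑ᶠ y' ∈ π ⁻¹' ({x} : Set X), pairTangencyAt ζ' (Sum.inl k) (Sum.inl l) y' =
      pairTangencyAt ζ' (Sum.inl k) (Sum.inl l) (j k c) := by
    refine finsum_mem_eq_of_forall_ne_eq_zero hc fun y' hy' hne => pairTangencyAt_of_not_through fun h => hne ?_
    exact eq_of_inl_specializes C j ζ' hinl hy' h.1 hc
  rw [hsum]
  -- the old term at `x`
  have hb : pairLength (ζ k) (ζ l) x ≠ ⊤ :=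
    pairLength_ne_top hX hR2 hk hl (hcoh k) (hcoh l) fun e => hkl (hζinj e)
  have hb1 : 1 ≤ pairLength (ζ k) (ζ l) x := one_le_pairLength hk hl
  have hT : pairTangencyAt ζ k l x = (pairLength (ζ k) (ζ l) x).toNat - 1 :=
    pairTangencyAt_of_through ⟨hk, hζx k, hl, hζx l⟩
  -- data of the lifted branches at `j_k c`
  subst hc
  have hkc : ζ' (Sum.inl k) ⤳ j k c := by rw [hinl]; exact (genericPoint_specializes c).map (j k).continuous
  have hkne : ζ' (Sum.inl k) ≠ j k c := fun e => hζx k (by rw [← hjζ k, ← hinl, e])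
  have hcohk : Order.coheight (π (j k (genericPoint (C k)))) = 1 := by rw [hjζ]; exact hcoh k
  have hgen_ne : π (j k (genericPoint (C k))) ≠ π (j k c) := by rw [hjζ]; exact hζx k
  have hlne' : ζ' (Sum.inl l) ≠ j k c := fun e => hζx l (by rw [← hjζ l, ← hinl, e])
  have hlx : π (ζ' (Sum.inl l)) ≠ π (j k c) := by rw [hinl, hjζ]; exact hζx l
  have hcohl : Order.coheight (ζ' (Sum.inl l)) = 1 := by
    rw [coheight_eq_of_apply_ne hx hπ hlx, hinl, hjζ]; exact hcoh l
  have hb1' : 1 ≤ (pairLength (ζ k) (ζ l) (π (j k c))).toNat := by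
    have := ENat.toNat_le_toNat hb1 hb
    rwa [ENat.toNat_one] at this
  by_cases hlc : ζ' (Sum.inl l) ⤳ j k c
  · -- Noether's inequality at `j_k c`
    have hne' : ζ' (Sum.inl l) ≠ j k (genericPoint (C k)) := fun e =>
      hkl (hζinj (by rw [← hjζ k, ← hjζ l, ← hinl l, e])).symm
    have hU3 := pairLength_lift_add_one_le hX (j k) hx hxne hπ hgen_ne hcohk hlc hcohl hlx hne'
    rw [hjζ, ← hinl] at hU3
    have hπl : π (ζ' (Sum.inl l)) = ζ l := by rw [hinl, hjζ]
    rw [hπl] at hU3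
    -- `a + 1 ≤ b` with `b` finite
    have ha : pairLength (ζ' (Sum.inl k)) (ζ' (Sum.inl l)) (j k c) ≠ ⊤ := by
      intro h
      rw [h, top_add] at hU3
      exact hb (top_le_iff.mp hU3)
    have ha1 : 1 ≤ (pairLength (ζ' (Sum.inl k)) (ζ' (Sum.inl l)) (j k c)).toNat := by
      have := ENat.toNat_le_toNat (one_le_pairLength hkc hlc) ha
      rwa [ENat.toNat_one] at this
    have hab : (pairLength (ζ' (Sum.inl k)) (ζ' (Sum.inl l)) (j k c)).toNat + 1 ≤
        (pairLength (ζ k) (ζ l) (π (j k c))).toNat := by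
      have := ENat.toNat_le_toNat hU3 hb
      rwa [ENat.toNat_add ha ENat.one_ne_top, ENat.toNat_one] at this
    rw [pairTangencyAt_of_through ⟨hkc, hkne, hlc, hlne'⟩, hT]
    constructor
    · omega
    · intro _ _ _
      omega
  · -- the branch `l` misses `j_k c`: the sum over `x` vanishes
    rw [pairTangencyAt_of_not_through fun h => hlc h.2.2.1, hT]
    refine ⟨Nat.zero_le _, fun _ _ htan => ?_⟩
    have hne1 : pairLength (ζ k) (ζ l) (π (j k c)) ≠ 1 := by
      rw [pairLength_def]
      exact fun h => htan ((length_quotient_eq_one_iff _).mp h)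
    have h2 : (pairLength (ζ k) (ζ l) (π (j k c))).toNat ≠ 1 := by
      intro h
      apply hne1
      rw [← ENat.coe_toNat hb, h]; rfl
    omega

include hX hxne hR2 hπ hζinj hcoh hζx hjζ hinl in
/-- **If all pairs of branches through `x` are transversal, every point over `x` carries at most two branches of the new
family** (two old branches through one point over `x` would have `i′ ≥ 1`, contradicting `i′ + 1 ≤ i_x = 1`; and `σ` is a
subsingleton). [cite: Hartshorne1977, Ch. V Cor. 3.7] -/
theorem branchCount_le_two_of_transversal [Finite ι] [Finite σ] [Subsingleton σ]
    (htr : ∀ k l, k ≠ l → ζ k ⤳ x → ζ l ⤳ x →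
      stalkIdeal (primeDivisorIdeal (ζ k)) x ⊔ stalkIdeal (primeDivisorIdeal (ζ l)) x = maximalIdeal (X.presheaf.stalk x))
    {y' : X'} (hy' : π y' = x) : branchCount ζ' y' ≤ 2 := by
  -- two distinct old branches cannot pass through the same point over `x`
  have hkey : ∀ k l, k ≠ l → ζ' (Sum.inl k) ⤳ y' → ζ' (Sum.inl l) ⤳ y' → False := by
    intro k l hkl hk hl
    have hkx := specializes_of_inl_specializes ζ C j hjζ ζ' hinl hy' hk
    have hlx' := specializes_of_inl_specializes ζ C j hjζ ζ' hinl hy' hl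
    obtain ⟨c, hc⟩ := exists_apply_eq_of_specializes ζ C j hjζ hkx
    have hyc := eq_of_inl_specializes C j ζ' hinl hy' hk hc
    subst hyc; subst hc
    have hcohk : Order.coheight (π (j k (genericPoint (C k)))) = 1 := by rw [hjζ]; exact hcoh k
    have hgen_ne : π (j k (genericPoint (C k))) ≠ π (j k c) := by rw [hjζ]; exact hζx k
    have hlx : π (ζ' (Sum.inl l)) ≠ π (j k c) := by rw [hinl, hjζ]; exact hζx l
    have hcohl : Order.coheight (ζ' (Sum.inl l)) = 1 := by
      rw [coheight_eq_of_apply_ne hx hπ hlx, hinl, hjζ]; exact hcoh l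
    have hne' : ζ' (Sum.inl l) ≠ j k (genericPoint (C k)) := fun e =>
      hkl (hζinj (by rw [← hjζ k, ← hjζ l, ← hinl l, e])).symm
    have hU3 := pairLength_lift_add_one_le hX (j k) hx hxne hπ hgen_ne hcohk hl hcohl hlx hne'
    have hπl : π (ζ' (Sum.inl l)) = ζ l := by rw [hinl, hjζ]
    rw [hjζ, hπl, pairLength_def (ζ k), htr k l hkl hkx hlx', (length_quotient_eq_one_iff _).mpr rfl] at hU3
    have hkc : j k (genericPoint (C k)) ⤳ j k c := (genericPoint_specializes c).map (j k).continuous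
    have h1 := one_le_pairLength hkc hl
    have : (1 : ℕ∞) + 1 ≤ 1 := (add_le_add h1 le_rfl).trans hU3
    exact absurd this (by decide)
  -- hence `k' ↦ isLeft k'` is injective on the branches through `y'`
  rw [branchCount_def]
  have hcard := Nat.card_le_card_of_injective
    (fun b : {k' : ι ⊕ σ // ζ' k' ⤳ y' ∧ ζ' k' ≠ y'} => b.1.isLeft) ?_
  · simpa using hcard
  · rintro ⟨k₁ | s₁, h₁⟩ ⟨k₂ | s₂, h₂⟩ h
    · by_cases e : k₁ = k₂
      · subst e; rfl
      · exact (hkey k₁ k₂ e h₁.1 h₂.1).elim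
    · simp at h
    · simp at h
    · have e : s₁ = s₂ := Subsingleton.elim _ _
      subst e; rfl

end Fibre

end CampaignW46

end Summit.ResolutionOfSingularities.ResolutionOfSingularities.Theorems

end
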